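import Mathlib
import HarnessLib
import Literature.AlgebraicGeometry.DeterminantalHypersurfaces.HeltonVinnikov
import Summits.ValiantsHypothesis.ValiantsHypothesis.Theorems.PermanentalConesHyperbolicVPShadowNetzerSanyal
import Summits.ValiantsHypothesis.ValiantsHypothesis.Theorems.PermanentalConesHyperbolicVPShadowIrreducibleReduction
import Summits.ValiantsHypothesis.ValiantsHypothesis.Theorems.PermanentalConesHyperbolicVPShadowStubTernaryPencilHyperbolicForm
import Summits.ValiantsHypothesis.ValiantsHypothesis.Theorems.PermanentalConesHyperbolicVPShadowStubSpectrahedronOfSymmDetIdentity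
import Summits.ValiantsHypothesis.ValiantsHypothesis.Theorems.PermanentalConesHyperbolicVPShadowStubLowEffGlue
import Summits.ValiantsHypothesis.ValiantsHypothesis.Theorems.PermanentalConesHyperbolicVPShadowStubSpanDimLeThreeOfLeTwo
import Summits.ValiantsHypothesis.ValiantsHypothesis.Theorems.BorderApolarityGctBridge

/-!
# ValiantsHypothesis / PermanentalCones — `HyperbolicVPShadow`: the high layer (with Lax) still
# contains the Netzer–Sanyal conjecture

Route `PermanentalCones`, item `stmt-ValiantsHypothesis-8655` (crux `HyperbolicVPShadow`), line
`birth`, stub `stub_highEff_netzerSanyal` (a SUPPORT stub: the "still open-problem-complete"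
certificate of the c3 reshape of the crux).

The lead's c3 skeleton splits the open stub B′ (irreducible, non-symmetrisable real-spectrum linear
pencils have quasi-polynomially sized lifted-LMI nonnegative-spectrum cones) into

* the Helton–Vinnikov layer — pencils `P` with `dim span (1, range P) ≤ 3`, closed by the landed
  stubs T (`stub_ternaryPencil_hyperbolicForm`), S (`stub_spectrahedron_of_symmDetIdentity`) and
  the glue G (`stub_lowEff_glue`), conditionally on the Lax conjecture (the named fact
  `LewisParriloRamana2005_laxConjecture`, entering only as a hypothesis), and
* the open HIGH layer H — the same pencils with `dim span (1, range P) > 3` and `N ≥ 3` (the case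
  `N ≤ 2` being empty by the landed stub D₂ `stub_spanDim_le_three_of_le_two`).

This file certifies that H has not been trivialised: **H together with the Lax conjecture implies
the Netzer–Sanyal conjecture** "every closed hyperbolicity cone of a real homogeneous hyperbolic
form is a spectrahedral shadow" (Math. Program. 153 (2015), p. 6; open in general). Proof:
H ∧ Lax ⇒ B′ (the skeleton's composition, reproduced here), B′ ⇒ B
(`permanentalCones_realSpectrumShadow_of_irreducible_nonsymmetrizable`), B ⇒ (NS)
(`permanentalCones_netzerSanyal_of_realSpectrumShadow`). All steps are compositions of landed
theorems (the bound arithmetic `N ≤ 2^((log₂ N + c + 1)^(c+1))`,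
`(a + c)^c ≤ (a + c + 1)^(c+1)` is reused from `BorderApolarityGctBridge`); no claim is made in the
other direction.
-/

-- `<Problem> = <Summit>` for this single-conjunct summit (lakefile sets the same option tree-wide).
set_option linter.dupNamespace false

namespace Summit.ValiantsHypothesis.ValiantsHypothesis.Theorems

open Matrix
open Literature.AlgebraicGeometry.HyperbolicPolynomials

/-- **H ∧ Lax ⇒ (NS)** (stub `stub_highEff_netzerSanyal` of the c3 skeleton of crux
`HyperbolicVPShadow`, item `stmt-ValiantsHypothesis-8655`). The open high layer H of the crux —
for an absolute `c`, every IRREDUCIBLE, NOT simultaneously symmetrisable linear pencil `P` of real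
`N × N` matrices (`N ≥ 3`) with only real eigenvalues and `dim span (1, range P) > 3` has a closed
nonnegative-spectrum cone `{x : ∀ τ > 0, det (P x + τ·1) ≠ 0}` that is a lifted-LMI set of size
`≤ 2^((log₂ N + c)^c)` — together with the Lax conjecture (`LewisParriloRamana2005_laxConjecture`,
taken as a hypothesis) implies the Netzer–Sanyal conjecture: every closed hyperbolicity cone of a
real homogeneous form hyperbolic w.r.t. `e` is a spectrahedral shadow. Proof: H and Lax give
stub B′ through the landed Helton–Vinnikov layer (`stub_lowEff_glue` with
`stub_ternaryPencil_hyperbolicForm`, `stub_spectrahedron_of_symmDetIdentity`, and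
`stub_spanDim_le_three_of_le_two` for `N ≤ 2`), B′ gives stub B
(`permanentalCones_realSpectrumShadow_of_irreducible_nonsymmetrizable`) and B gives (NS)
(`permanentalCones_netzerSanyal_of_realSpectrumShadow`). So the c3 reshape leaves the registered
open stub open-problem-complete. [folklore] -/
theorem stub_highEff_netzerSanyal :
    (∃ c : ℕ, ∀ (n N : ℕ) (P : (Fin n → ℝ) →ₗ[ℝ] Matrix (Fin N) (Fin N) ℝ),
      (∀ (x : Fin n → ℝ) (z : ℂ),
        ((P x).map (algebraMap ℝ ℂ) - z • (1 : Matrix (Fin N) (Fin N) ℂ)).det = 0 → z.im = 0) →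
      (∀ W : Submodule ℝ (Fin N → ℝ), (∀ (x : Fin n → ℝ), ∀ v ∈ W, Matrix.mulVec (P x) v ∈ W) →
        W = ⊥ ∨ W = ⊤) →
      (¬ ∃ S : Matrix (Fin N) (Fin N) ℝ, S.PosDef ∧ ∀ x : Fin n → ℝ, (S * P x).IsSymm) →
      3 < Module.finrank ℝ (Submodule.span ℝ
        (insert (1 : Matrix (Fin N) (Fin N) ℝ) (Set.range P))) →
      3 ≤ N →
      ∃ m ≤ 2 ^ ((Nat.log 2 N + c) ^ c),
        Literature.AlgebraicGeometry.HyperbolicPolynomials.IsSpectrahedralShadowOfSize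
          {x : Fin n → ℝ | ∀ τ : ℝ, 0 < τ → (P x + τ • (1 : Matrix (Fin N) (Fin N) ℝ)).det ≠ 0} m) →
    Literature.AlgebraicGeometry.DeterminantalHypersurfaces.LewisParriloRamana2005_laxConjecture →
    ∀ (k : ℕ) (f : MvPolynomial (Fin k) ℝ) (e : Fin k → ℝ) (d : ℕ), f.IsHomogeneous d →
      Literature.AlgebraicGeometry.HyperbolicPolynomials.IsHyperbolic f e →
      Literature.AlgebraicGeometry.HyperbolicPolynomials.IsSpectrahedralShadow
        (Literature.AlgebraicGeometry.HyperbolicPolynomials.hyperbolicityCone f e) := by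
  intro hH hLax
  -- stub B′: irreducible, non-symmetrisable real-spectrum pencils, from the two layers
  have hB' : ∃ c : ℕ, ∀ (n N : ℕ) (P : (Fin n → ℝ) →ₗ[ℝ] Matrix (Fin N) (Fin N) ℝ),
      (∀ (x : Fin n → ℝ) (z : ℂ),
        ((P x).map (algebraMap ℝ ℂ) - z • (1 : Matrix (Fin N) (Fin N) ℂ)).det = 0 → z.im = 0) →
      (∀ W : Submodule ℝ (Fin N → ℝ), (∀ (x : Fin n → ℝ), ∀ v ∈ W, Matrix.mulVec (P x) v ∈ W) →
        W = ⊥ ∨ W = ⊤) →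
      (¬ ∃ S : Matrix (Fin N) (Fin N) ℝ, S.PosDef ∧ ∀ x : Fin n → ℝ, (S * P x).IsSymm) →
      ∃ m ≤ 2 ^ ((Nat.log 2 N + c) ^ c),
        Literature.AlgebraicGeometry.HyperbolicPolynomials.IsSpectrahedralShadowOfSize
          {x : Fin n → ℝ | ∀ τ : ℝ, 0 < τ → (P x + τ • (1 : Matrix (Fin N) (Fin N) ℝ)).det ≠ 0}
            m := by
    obtain ⟨c, hc⟩ := hH
    refine ⟨c + 1, fun n N P hP hirr hns => ?_⟩
    rcases le_or_gt (Module.finrank ℝ (Submodule.span ℝ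
        (insert (1 : Matrix (Fin N) (Fin N) ℝ) (Set.range P)))) 3 with hlow | hhigh
    · -- Helton–Vinnikov layer: a genuine spectrahedron of size `N`
      exact ⟨N, BorderApolarityGctBridge.le_two_pow_log_add_succ_pow N c, stub_lowEff_glue
        stub_ternaryPencil_hyperbolicForm hLax stub_spectrahedron_of_symmDetIdentity n N P hP hlow⟩
    · -- high layer (then `3 ≤ N` by stub D₂): the hypothesis H
      have hN3 : 3 ≤ N := by
        by_contra hlt
        exact absurd hhigh (not_lt.2 (stub_spanDim_le_three_of_le_two n N P (by omega) hP))
      obtain ⟨m, hm, h⟩ := hc n N P hP hirr hns hhigh hN3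
      exact ⟨m, hm.trans (Nat.pow_le_pow_right (by norm_num)
          (BorderApolarityGctBridge.add_pow_le_add_succ_pow_succ _ c)), h⟩
  exact permanentalCones_netzerSanyal_of_realSpectrumShadow
    (permanentalCones_realSpectrumShadow_of_irreducible_nonsymmetrizable hB')

end Summit.ValiantsHypothesis.ValiantsHypothesis.Theorems
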